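import Summits.CriticalPhenomena.Ising3DConformalLimit.Theorems.OneArmHyperscaling.Negative.KSliceAndExponentLadder
import HarnessLib

/-!
# `OneArmHyperscaling` (item stmt-CriticalPhenomena-15591): the weak end of its exponent ladder is "polynomial one-arm decay"

Negative / structural knowledge about the crux
`Summit.CriticalPhenomena.Ising3DConformalLimit.Theses.ArmHyperscaling.OneArmHyperscaling`
(route ArmHyperscaling, r2), from the standing crux disprover (cdisprove, cycle 1; work file
`Cruxes/OneArmHyperscaling/Disproof.lean`; companion of `Negative/KSliceAndExponentLadder.lean`, whose
helpers it reuses). THEOREM-ONLY, no new definitions.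
Notation: `m⁺_L = ⟨σ₀⟩⁺_{Λ_L;β_c(3),0}`, `G(x) = ⟨σ₀σ_x⟩_{β_c(3)}`; the ladder rung `p` is
`∃ K ≥ 1, ∃ C, ∀ n ≥ 1, (m⁺_{Kn})^p ≤ C·G(2ne₀)` (real power); the crux is `p = 2`, rungs `p < 1` are
false (`not_oneArmHyperscalingExp_of_lt_one`), larger `p` is weaker.

* `exists_oneArmExp_iff_polyDecay` — **some rung `p > 0` holds iff `m⁺_L ≤ C·L^{-a}` for all `L ≥ 1`, for
  some `a > 0`** (⇒: `(m⁺_{Kn})^p ≤ C C₁/n` by the infrared bound, `p`-th root, GKS volume monotonicity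
  to leave the multiples of `K`; ⇐: `p = 2/a`, `K = 1`, Simon–Lieb `G(2ne₀) ≥ c/n²`). A polynomial
  upper bound on `m⁺_L` with ANY exponent on `ℤ³` is recorded as open by van Engelenburg–Garban–Panis–
  Severo (arXiv:2510.23423, after Thm 1.12; also Panis, arXiv:2406.15243, §1.4.1, Open Problem 1). Hence
  EVERY rung `p ≥ 1` of the crux's ladder is open today and the crux is its sharp rung: the reason the
  statement resists both proof and cheap refutation.

References: D. van Engelenburg, C. Garban, R. Panis, F. Severo, arXiv:2510.23423 (2025); R. Panis,
arXiv:2406.15243 (2024), §1.4.1; B. Simon, Comm. Math. Phys. 77 (1980) 111; J. Fröhlich, B. Simon,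
T. Spencer, Comm. Math. Phys. 50 (1976) 79.
-/

noncomputable section

namespace Summit.CriticalPhenomena.Ising3DConformalLimit.OneArmHyperscalingNegative

open Literature.Probability.LatticeModels Finset Filter Topology

/-- **Some rung of the ladder ⇔ polynomial one-arm decay.** [cite: VanEngelenburgGarbanPanisSevero2025, Theorem 1.1] -/
theorem exists_oneArmExp_iff_polyDecay :
    (∃ p : ℝ, 0 < p ∧ ∃ K : ℕ, 1 ≤ K ∧ ∃ C : ℝ, ∀ n : ℕ, 1 ≤ n →
        (isingCorr (zdGraph 3) (box 3 (K * n)) (criticalBeta 3) 0 BoundaryCondition.plus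
          ({0} : Finset (Site 3))) ^ p ≤ C * criticalTwoPoint 3 (Pi.single 0 (2 * (n : ℤ)))) ↔
      ∃ a : ℝ, 0 < a ∧ ∃ C : ℝ, ∀ L : ℕ, 1 ≤ L →
        isingCorr (zdGraph 3) (box 3 L) (criticalBeta 3) 0 BoundaryCondition.plus
          ({0} : Finset (Site 3)) ≤ C * (L : ℝ) ^ (-a) := by
  set m : ℕ → ℝ := fun L =>
    isingCorr (zdGraph 3) (box 3 L) (criticalBeta 3) 0 BoundaryCondition.plus ({0} : Finset (Site 3))
    with hmdef
  have hm0 : ∀ L, 0 ≤ m L := fun L => boxMag_nonneg L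
  have hm1 : ∀ L, m L ≤ 1 := fun L => boxMag_le_one L
  have hmpos : ∀ L, 0 < m L := fun L => boxMag_pos L
  have hanti : ∀ {L L' : ℕ}, L ≤ L' → m L' ≤ m L := fun h =>
    isingCorr_plus_le_of_subset (zdGraph 3) (criticalBeta_nonneg 3) le_rfl
      (Finset.singleton_subset_iff.2 (zero_mem_box 3 _)) (box_mono 3 h)
  show (∃ p : ℝ, 0 < p ∧ ∃ K : ℕ, 1 ≤ K ∧ ∃ C : ℝ, ∀ n : ℕ, 1 ≤ n →
      m (K * n) ^ p ≤ C * criticalTwoPoint 3 (Pi.single 0 (2 * (n : ℤ)))) ↔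
    ∃ a : ℝ, 0 < a ∧ ∃ C : ℝ, ∀ L : ℕ, 1 ≤ L → m L ≤ C * (L : ℝ) ^ (-a)
  constructor
  · rintro ⟨p, hp, K, hK, C, hC⟩
    obtain ⟨C₁, hC₁, hup⟩ := axisTwoPoint_le
    have hK0 : (0 : ℝ) < K := by exact_mod_cast hK
    set B : ℝ := max C 0 * C₁ with hB
    have hB0 : 0 ≤ B := by positivity
    have hmul : ∀ n : ℕ, 1 ≤ n → m (K * n) ≤ (B / n) ^ (1 / p) := by
      intro n hn
      have hn0 : (0 : ℝ) < n := by exact_mod_cast hn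
      have h1 : m (K * n) ^ p ≤ B / n := by
        have := (hC n hn).trans ((mul_le_mul_of_nonneg_right (le_max_left _ _)
          (axisTwoPoint_pos hn).le).trans (mul_le_mul_of_nonneg_left (hup n hn) (le_max_right _ _)))
        rwa [← mul_div_assoc] at this
      have h2 := Real.rpow_le_rpow (Real.rpow_nonneg (hm0 _) p) h1 (by positivity : (0:ℝ) ≤ 1 / p)
      rw [one_div] at h2 ⊢
      rwa [Real.rpow_rpow_inv (hm0 _) hp.ne'] at h2
    refine ⟨1 / p, by positivity, max (B ^ (1 / p) * ((2 * K : ℕ) : ℝ) ^ (1 / p)) ((K : ℝ) ^ (1 / p)),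
      fun L hL => ?_⟩
    have hL0 : (0 : ℝ) < L := by exact_mod_cast hL
    rcases lt_or_ge L K with hLK | hLK
    · have h1 : (1 : ℝ) ≤ (K : ℝ) ^ (1 / p) * (L : ℝ) ^ (-(1 / p)) := by
        rw [Real.rpow_neg hL0.le, ← div_eq_mul_inv, le_div_iff₀ (Real.rpow_pos_of_pos hL0 _), one_mul]
        exact Real.rpow_le_rpow hL0.le (by exact_mod_cast hLK.le) (by positivity)
      calc m L ≤ 1 := hm1 L
        _ ≤ (K : ℝ) ^ (1 / p) * (L : ℝ) ^ (-(1 / p)) := h1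
        _ ≤ _ := by gcongr; exact le_max_right _ _
    · set n : ℕ := L / K with hn
      have hn1 : 1 ≤ n := (Nat.one_le_div_iff (by omega)).2 hLK
      have hn0 : (0 : ℝ) < n := by exact_mod_cast hn1
      have hKn : K * n ≤ L := Nat.mul_div_le L K
      have hL2 : L < 2 * K * n := by
        have := Nat.lt_mul_div_succ L (show 0 < K by omega)
        nlinarith
      have h1 : m L ≤ (B / n) ^ (1 / p) := (hanti hKn).trans (hmul n hn1)
      have h2 : (B / n) ^ (1 / p) = B ^ (1 / p) * (n : ℝ) ^ (-(1 / p)) := by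
        rw [Real.div_rpow hB0 hn0.le, Real.rpow_neg hn0.le, div_eq_mul_inv]
      have h3 : (n : ℝ) ^ (-(1 / p)) ≤ ((2 * K : ℕ) : ℝ) ^ (1 / p) * (L : ℝ) ^ (-(1 / p)) := by
        have hL2' : (L : ℝ) ≤ ((2 * K : ℕ) : ℝ) * n := by exact_mod_cast hL2.le
        have h4 : ((L : ℝ) / ((2 * K : ℕ) : ℝ)) ^ (1 / p) ≤ (n : ℝ) ^ (1 / p) := by
          refine Real.rpow_le_rpow (by positivity) ?_ (by positivity)
          rw [div_le_iff₀ (by positivity)]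
          linarith
        rw [Real.div_rpow hL0.le (by positivity)] at h4
        rw [Real.rpow_neg hn0.le, Real.rpow_neg hL0.le, ← div_eq_mul_inv,
          le_div_iff₀ (Real.rpow_pos_of_pos hL0 _)]
        rw [div_le_iff₀ (Real.rpow_pos_of_pos (by positivity) _)] at h4
        rw [inv_mul_le_iff₀ (Real.rpow_pos_of_pos hn0 _)]
        linarith
      calc m L ≤ B ^ (1 / p) * (n : ℝ) ^ (-(1 / p)) := h2 ▸ h1
        _ ≤ B ^ (1 / p) * (((2 * K : ℕ) : ℝ) ^ (1 / p) * (L : ℝ) ^ (-(1 / p))) := by gcongr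
        _ = B ^ (1 / p) * ((2 * K : ℕ) : ℝ) ^ (1 / p) * (L : ℝ) ^ (-(1 / p)) := by ring
        _ ≤ _ := by gcongr; exact le_max_left _ _
  · rintro ⟨a, ha, C, hC⟩
    obtain ⟨c, hc, hG⟩ := le_axisTwoPoint
    have hCpos : 0 < C := by
      have h1 := hC 1 le_rfl
      have h2 := hmpos 1
      simp at h1
      linarith
    refine ⟨2 / a, by positivity, 1, le_rfl, C ^ (2 / a) / c, fun n hn => ?_⟩
    have hn0 : (0 : ℝ) < n := by exact_mod_cast hn
    rw [one_mul]
    have h1 : m n ^ (2 / a) ≤ (C * (n : ℝ) ^ (-a)) ^ (2 / a) :=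
      Real.rpow_le_rpow (hm0 _) (hC n hn) (by positivity)
    have h2 : (C * (n : ℝ) ^ (-a)) ^ (2 / a) = C ^ (2 / a) * ((n : ℝ) ^ 2)⁻¹ := by
      rw [Real.mul_rpow hCpos.le (Real.rpow_nonneg hn0.le _), ← Real.rpow_mul hn0.le,
        show -a * (2 / a) = -(2 : ℕ) by rw [Nat.cast_ofNat]; field_simp, Real.rpow_neg hn0.le,
        Real.rpow_natCast]
    have h3 := hG n hn
    calc m n ^ (2 / a) ≤ C ^ (2 / a) * ((n : ℝ) ^ 2)⁻¹ := h2 ▸ h1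
      _ = C ^ (2 / a) / c * (c / (n : ℝ) ^ 2) := by field_simp
      _ ≤ C ^ (2 / a) / c * criticalTwoPoint 3 (Pi.single 0 (2 * (n : ℤ))) := by gcongr

end Summit.CriticalPhenomena.Ising3DConformalLimit.OneArmHyperscalingNegative

end
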